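import Summits.QuantumAdvantage.QuantumAdvantage.Theorems.LinnikCubicClassGroupsPureCubicClassGroupFBQPOfCubicEscape
import Summits.QuantumAdvantage.QuantumAdvantage.Theorems.LinnikCubicClassGroupsDegreeOnePrimesEscapeCubicEscape
import Summits.QuantumAdvantage.QuantumAdvantage.Theorems.LinnikCubicClassGroupsDegreeOnePrimesEscapeResidueBound
import Summits.QuantumAdvantage.QuantumAdvantage.Theorems.LinnikCubicClassGroupsDegreeOnePrimesEscapePerCharacterDeficitLocal
import HarnessLib

/-!
# The unconditional FBQP theorem for `h(ℚ(∛m))` modulo ONE analytic input: the lower prime ideal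
# theorem dichotomy T5 at degree `3`

Topic `Summits/QuantumAdvantage/QuantumAdvantage/Theorems`, route `LinnikCubicClassGroups`, helper for the crux
`DegreeOnePrimesEscape` (stmt-QuantumAdvantage-11543, its `n = 3` slice `CubicEscape`); cell B2b-1 (linnik-cubic),
PART B. HONEST FRAMING: the value of this file is a THEOREM (a kernel-checked reduction) — NOT summit progress.

All inputs of the `n = 3` slice except T5 are now theorems of the tree:
* R(3) `Residue.residueLowerBound_three` — `κ_K ≥ Q^{−10}` for every cubic field (Stark 1974, Lemma 4 + Theorem 1');
* T4(3) `perCharacterDeficitκ_of_le_four 3` — the one-sided per-character deficit, from the log-free zero density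
  for class-group twists `logFreeDensity_classGroup` (`n ≤ 4`);
* S `stub_starkNoQuadSubfield` (inside `CubicEscape.cubicEscape_of_kappaInputs`);
* the composition `CubicEscape.cubicEscape_of_kappaInputs` and the quantum half `fbqp_of_cubicEscape`.

Hence (`cubicEscape_of_lowerPIT`, `fbqp_of_lowerPIT`): **T5(3) at `A = 10`** — for cubic `K` with `κ_K ≥ Q^{−10}` and
`x ≥ Q^{C₁}`, either `29 Li(x) ≤ 32 π_K(x)` or `ζ_K` has a real zero `β₁ ∈ (1 − 1/(8 log Q), 1)` with
`(1 − β₁) log x < 4` — **implies `CubicEscape` and the FBQP theorem** "the low `2|x|+8` bits of `h(K)`, `K ∋ ∛(decodeNat x)`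
cubic, are an FBQP function of `x`". T5(3) follows from the log-free zero density for `ζ₁_K` at degree `3`
(`logFreeDensity_dedekindZeta₁_three`, landed) by the smoothed explicit formula; it is PART A's deliverable
(`lowerPITκ_three`), after which the sibling file `…PureCubicClassGroupFBQPUnconditional.lean` discharges `hL`.
-/

noncomputable section

namespace Summit.QuantumAdvantage.QuantumAdvantage.Theorems.LinnikCubicClassGroups

open scoped NumberField nonZeroDivisors
open NumberField
open Literature.NumberTheory.LFunctions Literature.NumberTheory.LFunctions.NumberField
open Summit.QuantumAdvantage.QuantumAdvantage.Theorems.DegreeOnePrimesEscape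

/-- **`CubicEscape` from T5(3)**: the body of `DegreeOnePrimesEscape` at `n = 3` follows from the lower prime ideal
theorem dichotomy for cubic fields with `κ_K ≥ Q^{−10}` — by `CubicEscape.cubicEscape_of_kappaInputs` at `A = 10` with
R(3) = `Residue.residueLowerBound_three` and T4(3) = `perCharacterDeficitκ_of_le_four 3`. -/
theorem cubicEscape_of_lowerPIT
    (hL : ∃ C₁ : ℝ, ∀ (K : Type) [Field K] [NumberField K], Module.finrank ℚ K = 3 →
      ThornerZaman.condQn K ^ (-(10 : ℝ)) ≤ NumberField.dedekindZeta_residue K →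
      ∀ x : ℝ, ThornerZaman.condQn K ^ C₁ ≤ x →
        29 * offsetLogIntegral x ≤ 32 * (primeIdealCount K x : ℝ) ∨
        ∃ β₁ : ℝ, 1 - 1 / (8 * Real.log (ThornerZaman.condQn K)) < β₁ ∧ β₁ < 1 ∧
          dedekindZetaCont K β₁ = 0 ∧ (1 - β₁) * Real.log x < 4) :
    ∃ C : ℕ, ∀ (K : Type) [Field K] [NumberField K], Module.finrank ℚ K = 3 →
      (∀ F : IntermediateField ℚ K, Module.finrank ℚ F ≠ 2) → ∀ x : ℕ, |NumberField.discr K| ^ C ≤ (x : ℤ) →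
      ∀ M : Subgroup (ClassGroup (NumberField.RingOfIntegers K)), M ≠ ⊤ →
        Nat.primeCounting x ≤ 8 * Set.ncard {P : Ideal (NumberField.RingOfIntegers K) | P.IsPrime ∧
          (Ideal.absNorm P).Prime ∧ Ideal.absNorm P ≤ x ∧
          ∃ hP : P ∈ nonZeroDivisors (Ideal (NumberField.RingOfIntegers K)), ClassGroup.mk0 ⟨P, hP⟩ ∉ M} :=
  CubicEscape.cubicEscape_of_kappaInputs (A := 10) (by norm_num) Residue.residueLowerBound_three
    (perCharacterDeficitκ_of_le_four 3 (by norm_num) (by norm_num) 10 (by norm_num)) hL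

/-- **The FBQP theorem from T5(3)**: the lower prime ideal theorem dichotomy for cubic fields with `κ_K ≥ Q^{−10}`
implies that some `f ∈ FBQP` with `|f x| = 2|x|+8` outputs the low `2|x|+8` bits of `h(K)` for every cubic number field
`K` containing a cube root of the non-cube `decodeNat x` (`fbqp_of_cubicEscape ∘ cubicEscape_of_lowerPIT`). -/
theorem fbqp_of_lowerPIT
    (hL : ∃ C₁ : ℝ, ∀ (K : Type) [Field K] [NumberField K], Module.finrank ℚ K = 3 →
      ThornerZaman.condQn K ^ (-(10 : ℝ)) ≤ NumberField.dedekindZeta_residue K →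
      ∀ x : ℝ, ThornerZaman.condQn K ^ C₁ ≤ x →
        29 * offsetLogIntegral x ≤ 32 * (primeIdealCount K x : ℝ) ∨
        ∃ β₁ : ℝ, 1 - 1 / (8 * Real.log (ThornerZaman.condQn K)) < β₁ ∧ β₁ < 1 ∧
          dedekindZetaCont K β₁ = 0 ∧ (1 - β₁) * Real.log x < 4) :
    ∃ f : List Bool → List Bool, f ∈ Literature.Computability.Cryptography.FBQP ∧
      (∀ x, (f x).length = 2 * x.length + 8) ∧
      ∀ (x : List Bool) (K : Type) [Field K] [NumberField K], Module.finrank ℚ K = 3 →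
        (∀ r : ℕ, r ^ 3 ≠ Computability.decodeNat x) → (∃ α : K, α ^ 3 = (Computability.decodeNat x : K)) →
        f x = List.ofFn (fun i : Fin (2 * x.length + 8) => (NumberField.classNumber K).testBit i.val) :=
  fbqp_of_cubicEscape (cubicEscape_of_lowerPIT hL)

end Summit.QuantumAdvantage.QuantumAdvantage.Theorems.LinnikCubicClassGroups

end
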